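import Mathlib
import Summits.Ventures.HodgeRepro.Tier4.Target
import Summits.Ventures.HodgeRepro.Tier4.Common.TargetBall
import Summits.Ventures.HodgeRepro.Tier4.Line3.KMDatum
import Summits.Ventures.HodgeRepro.Tier4.Line3.KMDatumS
import Summits.Ventures.HodgeRepro.Tier4.Line3.Defs
import Summits.Ventures.HodgeRepro.Tier4.Line3.LocaliserS
import Summits.Ventures.HodgeRepro.Tier4.Line3.HeckeEquivarianceLemmas
import Summits.Ventures.HodgeRepro.Tier4.Line3.TorusInvariance
import Summits.Ventures.HodgeRepro.Tier4.Line3.KernelEquivariance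
import Summits.Ventures.HodgeRepro.Tier4.Line3.ClassBoundLemmas
import Summits.Ventures.HodgeRepro.Tier4.Line3.ClassBoundGauss
import Summits.Ventures.HodgeRepro.Tier4.Line3.CongruenceIndex
import Summits.Ventures.HodgeRepro.Tier4.Line3.InvariantDensityTransfer
import Summits.Ventures.HodgeRepro.Tier4.Line3.OffMainInvariance
import Summits.Ventures.HodgeRepro.Tier4.Line3.MajInvariance

/-!
# Tier4/Line3/InvariantMajorantDef — the `Γ`-INVARIANT majorant of the off-main density (rung (I2′) of S12951)

Blind re-derivation cell `pub-hodge-repro`, Tier 4 «PROVE THE STEP» (README §9–§10), LINE L3, seat t4-L2-p3 (gen 2,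
on L3.5 `term_dominated`); support module for the residual `OffMainMass` of L3.5 through the invariant-majorant
route (`InvariantMajorantGlue.offMainMass_of_invariantMajorant`).

The class bound of L3.5 majorises each off-main summand `coefQ (loc N) (rep w) · kernel (rep w) z` by a product of
(i) the coefficient majorant `∏_k (1 + ‖ballCoord x_k‖)^e · gaussDefAt c₁ x_k` of `LocS.growth`, (ii) the kernel, and
(iii) a decay `e^{−κ q^{N/d}}`.  (i) is NOT `Γ`-invariant (ball coordinates at `τ₀`), which is what forces the good
domain / the archimedean size of coset representatives on the other route (S12951 (1)).  This module defines the
majorant in a `Γ`-INVARIANT shape: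

* `gammaInf e c₁ x := ⨅ g : Fin 4 → Γ, ∏_k slotMaj e c₁ (g_k x_k)` — the infimum of the coefficient majorant over
  the `Γ⁴`-orbit of the quadruple: `Γ`-invariant by construction (`gammaInf_mulVec`), at most the value at any `g`
  (`gammaInf_le`), torus-invariant (`gammaInf_smul`);
* `kerMaj Φ x z := ‖kernel Φ x z‖ · ∏_k e^{(π/4) maj (ballCoord x_k) z}` — the kernel with a QUARTER of its Gaussian
  given back (the quarter pays the `τ₀`-decay in the invariant class bound); an EQUIVARIANT density
  (`kerMaj_equiv`: `|det Jac|² · kerMaj (g x) (g z) = kerMaj x z`, from `kernel_equiv` and `maj_actM`);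
* `invMajorant Φ e c₁ w z := gammaInf e c₁ (rep w) · kerMaj Φ (rep w) z` — a function of the line tuple
  (`invMajorant_eq_of_lines_eq`);
* `invMajorantDensity Φ S′ xm e c₁ z := Σ'_{w ∈ S′, off-main} ofReal (invMajorant Φ e c₁ w z)` for a `Γ`-STABLE set `S′`
  of line tuples (`IsGammaStable`: `lines x ∈ S′ → lines (γ x) ∈ S′` for `γ ∈ Γ`).

**Theorem** (`invMajorantDensity_isInvariant`): the density is `Γ`-invariant, `IsInvariantDensity τ₀ C Γ (…)` — exactly
the hypothesis `hμ` of the glue.  Its proof is that of `OffMainInvariance.offMainDensity_isInvariant` with the summand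
replaced: the bijection `w ↦ γ · w` of the off-main tuples of `S′`, and termwise `|det Jac|² · invMajorant (γ w) (γ z)
= invMajorant w z`.  No printed input enters.  Nothing here asserts anything about the truth of (P); HC_CM is NOT
proved by anyone in this repository.
-/

set_option autoImplicit false

noncomputable section

namespace Summit.Ventures.HodgeRepro.Tier4.Line3

open Summit.Ventures.HodgeRepro.Tier4
open Matrix MeasureTheory
open scoped ComplexConjugate ENNReal

open HeckeEquivariance

namespace T4Data

variable (X : T4Data)

/-! ## 1. The slot majorant and its `Γ⁴`-orbit infimum -/

/-- The slot majorant of the coefficient (the shape of `LocS.growth`): polynomial growth in the ball coordinates times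
the definite Gaussian. -/
def slotMaj (e c₁ : ℝ) (y : Fin 3 → X.E) : ℝ :=
  (1 + ‖X.ballCoord y‖) ^ e * X.gaussDefAt c₁ y

/-- `0 ≤ slotMaj`. -/
theorem slotMaj_nonneg (e c₁ : ℝ) (y : Fin 3 → X.E) : 0 ≤ X.slotMaj e c₁ y :=
  mul_nonneg (Real.rpow_nonneg (by positivity) _) (X.gaussDefAt_nonneg _ _)

/-- The slot majorant is unchanged by a norm-one scalar. -/
theorem slotMaj_smul (e c₁ : ℝ) {t : X.E} (ht : X.c t * t = 1) (y : Fin 3 → X.E) :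
    X.slotMaj e c₁ (t • y) = X.slotMaj e c₁ y := by
  unfold slotMaj
  rw [X.norm_ballCoord_smul_tau_eq ht, X.gaussDefAt_smul c₁ ht]

/-- The coefficient majorant of a quadruple moved by `g ∈ Γ⁴`. -/
def quadMaj (e c₁ : ℝ) (x : X.Tuple) (g : Fin 4 → X.Γ) : ℝ :=
  ∏ k, X.slotMaj e c₁ ((g k).1 *ᵥ x k)

/-- `0 ≤ quadMaj`. -/
theorem quadMaj_nonneg (e c₁ : ℝ) (x : X.Tuple) (g : Fin 4 → X.Γ) : 0 ≤ X.quadMaj e c₁ x g :=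
  Finset.prod_nonneg fun _ _ => X.slotMaj_nonneg _ _ _

/-- **THE `Γ`-INVARIANT COEFFICIENT MAJORANT**: the infimum of the quadruple majorant over the `Γ⁴`-orbit. -/
def gammaInf (e c₁ : ℝ) (x : X.Tuple) : ℝ :=
  ⨅ g : Fin 4 → X.Γ, X.quadMaj e c₁ x g

/-- `Γ⁴` is inhabited (by `1`). -/
theorem nonempty_gammaFour : Nonempty (Fin 4 → X.Γ) :=
  ⟨fun _ => ⟨1, X.hΓ.1⟩⟩

/-- `0 ≤ gammaInf`. -/
theorem gammaInf_nonneg (e c₁ : ℝ) (x : X.Tuple) : 0 ≤ X.gammaInf e c₁ x :=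
  Real.iInf_nonneg fun g => X.quadMaj_nonneg e c₁ x g

/-- `gammaInf ≤ quadMaj g` for every `g ∈ Γ⁴`. -/
theorem gammaInf_le (e c₁ : ℝ) (x : X.Tuple) (g : Fin 4 → X.Γ) : X.gammaInf e c₁ x ≤ X.quadMaj e c₁ x g :=
  ciInf_le ⟨0, by rintro _ ⟨g, rfl⟩; exact X.quadMaj_nonneg e c₁ x g⟩ g

/-- A lower bound of every `quadMaj g` is a lower bound of `gammaInf`. -/
theorem le_gammaInf (e c₁ : ℝ) (x : X.Tuple) {a : ℝ} (h : ∀ g : Fin 4 → X.Γ, a ≤ X.quadMaj e c₁ x g) :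
    a ≤ X.gammaInf e c₁ x :=
  haveI := X.nonempty_gammaFour
  le_ciInf h

/-- The coefficient majorant is unchanged by norm-one scalars on the four vectors. -/
theorem gammaInf_smul (e c₁ : ℝ) (t : Fin 4 → X.E) (ht : ∀ k, X.c (t k) * t k = 1) (x : X.Tuple) :
    X.gammaInf e c₁ (fun k => t k • x k) = X.gammaInf e c₁ x := by
  unfold gammaInf quadMaj
  congr 1
  funext g
  refine Finset.prod_congr rfl fun k _ => ?_
  rw [Matrix.mulVec_smul, X.slotMaj_smul e c₁ (ht k)]

/-- **`Γ`-INVARIANCE** of the coefficient majorant: `gammaInf (γ x) = gammaInf x` for `γ ∈ Γ`. -/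
theorem gammaInf_mulVec (e c₁ : ℝ) {γ : Matrix (Fin 3) (Fin 3) X.E} (hγ : γ ∈ X.Γ) (x : X.Tuple) :
    X.gammaInf e c₁ (fun k => γ *ᵥ x k) = X.gammaInf e c₁ x := by
  obtain ⟨γ', hγ', hγγ', hγ'γ⟩ := exists_two_sided_inv_mem X.c X.H X.hΓ hγ
  -- right multiplication by `γ` is a surjection of `Γ⁴`
  have hsurj : Function.Surjective (fun g : Fin 4 → X.Γ => fun k => (⟨(g k).1 * γ, X.hΓ.2.1 _ (g k).2 γ hγ⟩ : X.Γ)) := by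
    intro g
    refine ⟨fun k => ⟨(g k).1 * γ', X.hΓ.2.1 _ (g k).2 γ' hγ'⟩, ?_⟩
    funext k
    apply Subtype.ext
    show (g k).1 * γ' * γ = (g k).1
    rw [Matrix.mul_assoc, hγ'γ, Matrix.mul_one]
  unfold gammaInf
  rw [← hsurj.iInf_comp (X.quadMaj e c₁ x)]
  congr 1
  funext g
  unfold quadMaj
  refine Finset.prod_congr rfl fun k _ => ?_
  show X.slotMaj e c₁ ((g k).1 *ᵥ (γ *ᵥ x k)) = X.slotMaj e c₁ (((g k).1 * γ) *ᵥ x k)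
  rw [Matrix.mulVec_mulVec]

/-! ## 2. The kernel majorant and the invariant majorant of a line tuple -/

/-- The kernel with a quarter of its Gaussian given back. -/
def kerMaj (D : X.ThetaData) (x : X.Tuple) (z : Fin 2 → ℂ) : ℝ :=
  ‖X.kernel D.Φ x z‖ * ∏ k, Real.exp (Real.pi / 4 * maj (X.ballCoord (x k)) z)

/-- `0 ≤ kerMaj`. -/
theorem kerMaj_nonneg (D : X.ThetaData) (x : X.Tuple) (z : Fin 2 → ℂ) : 0 ≤ X.kerMaj D x z :=
  mul_nonneg (norm_nonneg _) (Finset.prod_nonneg fun _ _ => (Real.exp_pos _).le)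

/-- The kernel majorant is unchanged by norm-one scalars on the four vectors. -/
theorem kerMaj_smul (D : X.ThetaData) (t : Fin 4 → X.E) (ht : ∀ k, X.c (t k) * t k = 1) (x : X.Tuple)
    (z : Fin 2 → ℂ) : X.kerMaj D (fun k => t k • x k) z = X.kerMaj D x z := by
  unfold kerMaj
  rw [X.kernel_smul D.Φ t ht x z]
  congr 1
  refine Finset.prod_congr rfl fun k _ => ?_
  rw [X.maj_ballCoord_smul_tau (ht k)]

/-- **THE KERNEL MAJORANT IS AN EQUIVARIANT DENSITY**: `|det Jac|² · kerMaj (g x) (g z) = kerMaj x z` for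
`g ∈ U(H)(E′)`, `z ∈ 𝔹` (the kernel transforms by `kernel_equiv`, the majorant is invariant by `maj_actM`). -/
theorem kerMaj_equiv (D : X.ThetaData) {g : Matrix (Fin 3) (Fin 3) X.E} (hg : IsUnitaryOf X.c X.H g) (x : X.Tuple)
    {z : Fin 2 → ℂ} (hz : z ∈ ball) :
    Complex.normSq (jacDetMap (actM (toBallMat X.τ₀ X.C g)) z) *
        X.kerMaj D (fun j => g *ᵥ x j) (actM (toBallMat X.τ₀ X.C g) z) = X.kerMaj D x z := by
  have hM : (toBallMat X.τ₀ X.C g)ᴴ * J * toBallMat X.τ₀ X.C g = J := toBallMat_J_of_unitary X hg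
  have hk : ‖X.kernel D.Φ x z‖ = Complex.normSq (jacDetMap (actM (toBallMat X.τ₀ X.C g)) z) *
      ‖X.kernel D.Φ (fun j => g *ᵥ x j) (actM (toBallMat X.τ₀ X.C g) z)‖ := by
    rw [X.kernel_equiv D hg x hz, norm_mul, Complex.norm_real, Real.norm_of_nonneg (Complex.normSq_nonneg _)]
  have hmaj : ∀ k, maj (X.ballCoord (g *ᵥ x k)) (actM (toBallMat X.τ₀ X.C g) z) = maj (X.ballCoord (x k)) z := by
    intro k
    rw [ballCoord_mulVec X g (x k), maj_actM hM _ hz]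
  unfold kerMaj
  simp only [hmaj]
  rw [hk]
  ring

/-- **THE INVARIANT MAJORANT** of a line tuple at `z`: the `Γ`-invariant coefficient majorant times the kernel
majorant, at the chosen representative. -/
def invMajorant (D : X.ThetaData) (e c₁ : ℝ) (w : X.LineTuple) (z : Fin 2 → ℂ) : ℝ :=
  X.gammaInf e c₁ (X.rep w) * X.kerMaj D (X.rep w) z

/-- `0 ≤ invMajorant`. -/
theorem invMajorant_nonneg (D : X.ThetaData) (e c₁ : ℝ) (w : X.LineTuple) (z : Fin 2 → ℂ) :
    0 ≤ X.invMajorant D e c₁ w z :=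
  mul_nonneg (X.gammaInf_nonneg _ _ _) (X.kerMaj_nonneg _ _ _)

/-- **THE INVARIANT MAJORANT AT ANY REPRESENTATIVE**: `invMajorant w z = gammaInf x · kerMaj x z` whenever
`lines x = w`. -/
theorem invMajorant_eq_of_lines_eq (D : X.ThetaData) (e c₁ : ℝ) {w : X.LineTuple} {x : X.Tuple}
    (hx : X.lines x = w) (z : Fin 2 → ℂ) :
    X.invMajorant D e c₁ w z = X.gammaInf e c₁ x * X.kerMaj D x z := by
  choose t ht hrep using fun k => X.rep_eq_smul_of_lines_eq hx k
  have hw : X.rep w = fun k => t k • x k := funext hrep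
  unfold invMajorant
  rw [hw, X.gammaInf_smul e c₁ t ht x, X.kerMaj_smul D t ht x z]

/-! ## 3. The invariant majorant density over a `Γ`-stable set of line tuples -/

/-- A set of line tuples is `Γ`-STABLE: the line tuple of `γ · x` is in it whenever that of `x` is (`γ ∈ Γ`). -/
def IsGammaStable (S' : Set X.LineTuple) : Prop :=
  ∀ γ ∈ X.Γ, ∀ x : X.Tuple, X.lines x ∈ S' → X.lines (fun j => γ *ᵥ x j) ∈ S'

/-- The off-main part of `S'`. -/
def invSet (S' : Set X.LineTuple) (xm : X.Tuple) : Set X.LineTuple :=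
  {w | w ∈ S' ∧ X.orbitOf w ≠ X.orbitOf (X.lines xm)}

/-- **THE INVARIANT MAJORANT DENSITY**: the sum of the invariant majorants over the off-main line tuples of `S'`. -/
def invMajorantDensity (D : X.ThetaData) (S' : Set X.LineTuple) (xm : X.Tuple) (e c₁ : ℝ) (z : Fin 2 → ℂ) :
    ℝ≥0∞ :=
  ∑' w : X.invSet S' xm, ENNReal.ofReal (X.invMajorant D e c₁ w.1 z)

/-- The off-main part of a `Γ`-stable set is stable under `γ · ` and its inverse (`γ ∈ Γ`). -/
theorem mem_invSet_tupleEquivOf_iff {S' : Set X.LineTuple} (hS : X.IsGammaStable S') (xm : X.Tuple)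
    {γ : Matrix (Fin 3) (Fin 3) X.E} (hγ : γ ∈ X.Γ) (hdet : IsUnit γ.det) (w : X.LineTuple) :
    tupleEquivOf X γ hdet w ∈ X.invSet S' xm ↔ w ∈ X.invSet S' xm := by
  have hγu : IsUnitaryOf X.c X.H γ := isUnitaryOf_of_mem_congruence X.hΓ hγ
  obtain ⟨γ', hγ', _, hγ'γ⟩ := exists_two_sided_inv_mem X.c X.H X.hΓ hγ
  unfold invSet
  simp only [Set.mem_setOf_eq]
  rw [orbitOf_tupleEquivOf X hγu hdet w]
  constructor
  · rintro ⟨h1, h2⟩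
    refine ⟨?_, h2⟩
    have h := hS γ' hγ' (fun j => γ *ᵥ X.rep w j) (by rwa [lines_mulVec_rep X γ hdet w])
    have hx : (fun j => γ' *ᵥ (γ *ᵥ X.rep w j)) = X.rep w := by
      funext j
      rw [Matrix.mulVec_mulVec, hγ'γ, Matrix.one_mulVec]
    rw [hx, X.lines_rep w] at h
    exact h
  · rintro ⟨h1, h2⟩
    refine ⟨?_, h2⟩
    rw [← lines_mulVec_rep X γ hdet w]
    exact hS γ hγ (X.rep w) (by rwa [X.lines_rep w])

/-- The bijection `w ↦ γ · w` of the off-main tuples of a `Γ`-stable set. -/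
def invSetEquiv {S' : Set X.LineTuple} (hS : X.IsGammaStable S') (xm : X.Tuple)
    {γ : Matrix (Fin 3) (Fin 3) X.E} (hγ : γ ∈ X.Γ) (hdet : IsUnit γ.det) :
    X.invSet S' xm ≃ X.invSet S' xm :=
  (tupleEquivOf X γ hdet).subtypeEquiv fun w => (X.mem_invSet_tupleEquivOf_iff hS xm hγ hdet w).symm

/-- **THE INVARIANT MAJORANT DENSITY IS `Γ`-INVARIANT** as a `|det Jac|²`-density — the hypothesis `hμ` of
`InvariantMajorantGlue.offMainMass_of_invariantMajorant`. -/
theorem invMajorantDensity_isInvariant (D : X.ThetaData) {S' : Set X.LineTuple} (hS : X.IsGammaStable S')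
    (xm : X.Tuple) (e c₁ : ℝ) :
    IsInvariantDensity X.τ₀ X.C X.Γ (X.invMajorantDensity D S' xm e c₁) := by
  rintro φ ⟨γ, hγ, rfl⟩ z hz
  have hγu : IsUnitaryOf X.c X.H γ := isUnitaryOf_of_mem_congruence X.hΓ hγ
  have hdet : IsUnit γ.det := isUnit_det_of_isUnitaryOf X hγu
  unfold invMajorantDensity
  rw [← ENNReal.tsum_mul_left, ← (X.invSetEquiv hS xm hγ hdet).tsum_eq]
  refine tsum_congr fun w => ?_
  show ENNReal.ofReal (Complex.normSq (jacDetMap (actM (toBallMat X.τ₀ X.C γ)) z)) *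
      ENNReal.ofReal (X.invMajorant D e c₁ (tupleEquivOf X γ hdet w.1) (actM (toBallMat X.τ₀ X.C γ) z)) =
    ENNReal.ofReal (X.invMajorant D e c₁ w.1 z)
  rw [← ENNReal.ofReal_mul (Complex.normSq_nonneg _)]
  congr 1
  rw [X.invMajorant_eq_of_lines_eq D e c₁ (lines_mulVec_rep X γ hdet w.1), X.gammaInf_mulVec e c₁ hγ]
  unfold invMajorant
  rw [← X.kerMaj_equiv D hγu (X.rep w.1) hz]
  ring

end T4Data

end Summit.Ventures.HodgeRepro.Tier4.Line3

end
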